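import Summits.QuantumFields.YangMills.Theorems.BalabanUVNodesPortU8Linearisation
import Summits.QuantumFields.YangMills.Theorems.BalabanUVNodesPortU8DecayConversion
import Summits.QuantumFields.YangMills.Theorems.BalabanUVNodesPortS1Chart
import Literature.MathematicalPhysics.QuantumFieldTheory.Balaban1983to89.B9Eq3117Current

/-!
# PORT PT-B (U8), g2 file 2 — PORT M: THE LINEARISED CURRENT (1.8) AT THE FLAT BACKGROUND, `dJ(1)[A] = −i ξ⁻³ π (d*dA)`, and the `𝐉`-BLOCK OF THE RESPONSES
# `chartMatJc (cutTo cX (G_k y)) b = −i ξ⁻³ π (d*d D_y)(b)`; with `D = Hr + dφ` (TokP9L) the lattice identity `d*d D = d*d Hr` and the BOUND of the `𝐉`-block by the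
# displayed fourth (190)-clause of ⁷″-LR4 (`‖d*d Hr‖ ≤ C₉′ξ³e^{−δ₉·tdist}`): `‖𝐉-block‖ ≤ 2‖π‖C₉′·e^{−δ₉·tdist}` — `--supports stmt-QuantumFields-27931` (helper; NOT a closer)

Cell `ym-nodeO-ideate` ∕ `ym-balaban-port`, porter `ymgap-nodeO-port-PTB-1` (gen 2), item **stmt-QuantumFields-27931** `BalabanUVNodes.PortPieceLocalityU8`.
[I] = [Balaban1987RG1], [15] = [Balaban1985Variational], [BP] = [Balaban1985BackgroundPropagators].

WHAT IS PROVED (0 `sorry`, 0 `def`, 0 `instance`; standard axioms).  GAUGE-INDEPENDENT lattice calculus — the current is gauge-COVARIANT and vanishes at the flat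
background, so its linearisation is the same for the rooted `D` and for print's Landau `Hr` (`d*d(dφ) = 0`); this row survives any edition of the chart `ι`.
§1 algebra of (1.8): `imPlaq_swap`∕`imPlaq_self` (antisymmetric plaquette function), ★ `current_eq_sum` — `J(𝐔)(x,μ) = −ξ⁻¹ Σ_ν D*_ν (ξ⁻²π Im ∂𝐔)_{μν}(x)` ([BP] (3.9) last form).
§2 one-parameter calculus at `𝐔 ≡ 1` for a family `W : ℝ → bonds → M₂(ℂ)ˣ` with `W 0 = 1`, `(W · b)' (0) = X b`: `hasDerivAt_units_inv_one` (`(W⁻¹)'(0) = −X`),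
  `hasDerivAt_plaqU_one` (`∂W(p)'(0) = (dX)(p)` = the lattice curl), `hasDerivAt_imPlaq_one` (`(ξ⁻²π Im ∂W)'(0) = −iξ⁻²π(dX)`), `hasDerivAt_covDstar_one`,
  ★★ `hasDerivAt_current_one` — **`(J(W))'(0)(x,μ) = ξ⁻¹ Σ_ν [(−iξ⁻²π dX)_{μν}(x) − (−iξ⁻²π dX)_{μν}(x − e_ν)]`** = `−iξ⁻³ π (d*dX)(x,μ)` (`current_lin_eq`, `norm_current_lin_le`).
§3 at the record (hypotheses = `recordGkJ_inl_eq`'s: the rooted background field differentiable at `B = 0` with derivative `U′`, `ι` differentiable): ★★ `recordGkJ_inr_eq` —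
  `G_k(y)(b, 𝐉, c) = sl2Coord (−iξ⁻³π(d*d U′δ)(b)) c`; ★★ `chartMatJc_cutTo_recordGkJ` — the `𝐉`-block chart matrix of the CUT response is `−iξ⁻³π(d*d U′δ)(b)` on `b ∈ X`, `0` off `X`.
§4 ★★★ `norm_chartMatJc_cutTo_recordGkJ_le_of_LR4` — with `U′δ b = Matrix.of (D b)`, `D b = Hr b + (φ b₋ − φ b₊)` and the LR4 clause `‖(d*d Hr)(b)‖ ≤ C₉′ξ³e^{−δ₉t}`:
  `‖chartMatJc (cutTo (recordCXJ X) (recordGkJ … a y)) b‖ ≤ 2·‖π_ℝ‖·C₉′·e^{−δ₉t}` (`π_ℝ = sl2Proj` as a real CLM; `d*d(dφ) = 0` is `curlF_of_exact`).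
HONEST FRAMING.  Lattice calculus + bookkeeping; the decay clause is a HYPOTHESIS (⁷″-LR4's displayed token, [15] (190) line 4 — CRIT-1 Q-9); NOTHING of Bałaban asserted;
27931 OPEN; K0⁷ NOT closed; NODE O 0∕1; COUNT 8∕28 · K 1∕4 UNMOVED; finite `𝕋⁴_{L^K}` at fixed ε — NOT continuum ∕ OS ∕ Clay; **the Yang–Mills mass gap (Clay) is NOT proved.**
-/

noncomputable section

open scoped BigOperators Matrix.Norms.L2Operator
open Complex (I)

namespace Summit.QuantumFields.YangMills.Theorems.PortU8

open Literature.MathematicalPhysics.QuantumFieldTheory.Balaban1983to89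
open Literature.MathematicalPhysics.QuantumFieldTheory.Balaban1983to89.Node00
open Literature.MathematicalPhysics.QuantumFieldTheory.Balaban1983to89.T4Continuum (T4Family)
open Literature.MathematicalPhysics.QuantumFieldTheory.Balaban1983to89.B9Eq39Adjoint (R covDstar plaqU divP divPη divP_eq_sum_of_antisymm covDstar_neg)
open Literature.MathematicalPhysics.QuantumFieldTheory.Balaban1983to89.B9TorusCalculus (torusT torusT_apply torusT_symm_apply)
open Literature.MathematicalPhysics.QuantumFieldTheory.Balaban1983to89.B12Eq18Current (dirForm dirForm_apply imPlaq current)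
open Literature.MathematicalPhysics.QuantumFieldTheory.Balaban1983to89.B9Eq37Insertion (imC imC_inv imC_one)
open Summit.QuantumFields.YangMills.Theorems.K0RecordFormatNames
open Summit.QuantumFields.YangMills.Theorems.BalabanUVNodesPortS1 (trace_sl2Proj)

/-! ## §1  Algebra of (1.8): the plaquette function is antisymmetric; the current as a single sum -/

section Algebra

variable {P : Params} {i : ℕ}

/-- `ξ⁻²π Im ∂𝐔(p_{νμ}(x)) = −ξ⁻²π Im ∂𝐔(p_{μν}(x))` (the reversed plaquette is the inverse: `B9Eq3117Current.plaqU_swap`, `imC_inv`).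
[cite: Balaban1985BackgroundPropagators, (3.1)–(3.2) p.390] -/
theorem imPlaq_swap (π : MatA 2 →ₗ[ℂ] MatA 2) (ξ : ℝ) (U : PBond P i → (MatA 2)ˣ) (μ ν : Fin P.d) (x : Site P i) :
    imPlaq π ξ U ν μ x = -imPlaq π ξ U μ ν x := by
  unfold imPlaq
  rw [B9Eq3117Current.imC_plaqU_swap, map_neg, smul_neg]

/-- `ξ⁻²π Im ∂𝐔(p_{μμ}(x)) = 0` (the degenerate plaquette variable is `1`). [cite: Balaban1985BackgroundPropagators, (3.1) p.390 (bookkeeping)] -/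
theorem imPlaq_self (π : MatA 2 →ₗ[ℂ] MatA 2) (ξ : ℝ) (U : PBond P i → (MatA 2)ˣ) (μ : Fin P.d) (x : Site P i) :
    imPlaq π ξ U μ μ x = 0 := by
  unfold imPlaq
  have h : plaqU (torusT P i) (dirForm U) μ μ x = 1 := by
    simp [plaqU, mul_assoc]
  rw [h, imC_one, map_zero, smul_zero]

/-- ★ **(1.8) AS A SINGLE SUM** ([BP] (3.9), last form, with the antisymmetry of `Im ∂𝐔`):
`J(𝐔)(x, μ) = −ξ⁻¹ · Σ_ν (D*_ν (ξ⁻²π Im ∂𝐔)_{μν})(x)`, `(D*_ν G)(x) = R(𝐔(x−e_ν,x)) G(x−e_ν) − G(x)`. [cite: Balaban1987RG1, (1.8) p.261; Balaban1985BackgroundPropagators, (3.9) p.392] -/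
theorem current_eq_sum (π : MatA 2 →ₗ[ℂ] MatA 2) (ξ : ℝ) (U : PBond P i → (MatA 2)ˣ) (b : PBond P i) :
    current π ξ U b = -(((ξ : ℂ)⁻¹) • ∑ ν : Fin P.d, covDstar (torusT P i) (dirForm U) ν (imPlaq π ξ U b.dir ν) b.src) := by
  rw [B12Eq18Current.current_apply, divP_eq_sum_of_antisymm (torusT P i) (dirForm U) (imPlaq π ξ U) (fun μ ν x => imPlaq_swap π ξ U μ ν x)
    (imPlaq_self π ξ U), ← smul_neg, ← Finset.sum_neg_distrib]
  congr 1
  refine Finset.sum_congr rfl fun ν _ => ?_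
  rw [show imPlaq π ξ U ν b.dir = -imPlaq π ξ U b.dir ν from funext fun x => imPlaq_swap π ξ U b.dir ν x, covDstar_neg]

end Algebra

/-! ## §2  One-parameter calculus at the flat background `𝐔 ≡ 1` -/

section Calculus

variable {P : Params} {i : ℕ}

/-- If a family of units `u t` has `u 0 = 1` and `(↑u)'(0) = X` then `(↑u⁻¹)'(0) = −X`. [cite: Balaban1985BackgroundPropagators, (3.5) p.391 (bookkeeping)] -/
theorem hasDerivAt_units_inv_one {u : ℝ → (MatA 2)ˣ} {X : MatA 2} (h1 : u 0 = 1) (hu : HasDerivAt (fun t => (u t : MatA 2)) X 0) :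
    HasDerivAt (fun t => (((u t)⁻¹ : (MatA 2)ˣ) : MatA 2)) (-X) 0 := by
  have hinv := (hasFDerivAt_ringInverse (𝕜 := ℝ) (u 0)).comp_hasDerivAt 0 hu
  have hfun : (fun t => (((u t)⁻¹ : (MatA 2)ˣ) : MatA 2)) = Ring.inverse ∘ fun t => (u t : MatA 2) := by
    funext t; simp
  rw [hfun]
  refine hinv.congr_deriv ?_
  rw [h1]
  simp

/-- **The plaquette variable linearised at `𝐔 ≡ 1` is the lattice curl**: `(∂W(p_{μν}(x)))'(0) = X(x,μ) + X(x+e_μ,ν) − X(x+e_ν,μ) − X(x,ν)`.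
[cite: Balaban1985BackgroundPropagators, (3.2)–(3.4) pp.390–391] -/
theorem hasDerivAt_plaqU_one {W : ℝ → PBond P i → (MatA 2)ˣ} {X : PBond P i → MatA 2} (h1 : ∀ b, W 0 b = 1)
    (hW : ∀ b, HasDerivAt (fun t => (W t b : MatA 2)) (X b) 0) (μ ν : Fin P.d) (x : Site P i) :
    HasDerivAt (fun t => (plaqU (torusT P i) (dirForm (W t)) μ ν x : MatA 2))
      (X ⟨x, μ⟩ + X ⟨x.shift μ, ν⟩ - X ⟨x.shift ν, μ⟩ - X ⟨x, ν⟩) 0 := by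
  have hfun : (fun t => (plaqU (torusT P i) (dirForm (W t)) μ ν x : MatA 2)) =
      fun t => (W t ⟨x, μ⟩ : MatA 2) * (W t ⟨x.shift μ, ν⟩ : MatA 2) * (((W t ⟨x.shift ν, μ⟩)⁻¹ : (MatA 2)ˣ) : MatA 2) *
        (((W t ⟨x, ν⟩)⁻¹ : (MatA 2)ˣ) : MatA 2) := by
    funext t; simp [plaqU, Units.val_mul]
  rw [hfun]
  have h := (((hW ⟨x, μ⟩).mul (hW ⟨x.shift μ, ν⟩)).mul (hasDerivAt_units_inv_one (h1 _) (hW ⟨x.shift ν, μ⟩))).mul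
    (hasDerivAt_units_inv_one (h1 _) (hW ⟨x, ν⟩))
  refine h.congr_deriv ?_
  simp only [Pi.mul_apply, h1, Units.val_one, inv_one, mul_one, one_mul, mul_neg]
  abel

/-- The plaquette family is `1` at `t = 0`. [cite: Balaban1985BackgroundPropagators, (3.1) p.390 (bookkeeping)] -/
theorem plaqU_zero_eq_one {W : ℝ → PBond P i → (MatA 2)ˣ} (h1 : ∀ b, W 0 b = 1) (μ ν : Fin P.d) (x : Site P i) :
    plaqU (torusT P i) (dirForm (W 0)) μ ν x = 1 := by
  simp [plaqU, h1]

/-- **`(ξ⁻²π Im ∂W(p))'(0) = −i ξ⁻² π (dX)(p)`** (`Im' (1) = −i·id`). [cite: Balaban1987RG1, (1.8) p.261; Balaban1985BackgroundPropagators, (3.4) p.391] -/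
theorem hasDerivAt_imPlaq_one {W : ℝ → PBond P i → (MatA 2)ˣ} {X : PBond P i → MatA 2} (h1 : ∀ b, W 0 b = 1)
    (hW : ∀ b, HasDerivAt (fun t => (W t b : MatA 2)) (X b) 0) (π : MatA 2 →ₗ[ℂ] MatA 2) (ξ : ℝ) (μ ν : Fin P.d) (x : Site P i) :
    HasDerivAt (fun t => imPlaq π ξ (W t) μ ν x)
      ((((ξ : ℂ)⁻¹) ^ 2) • ((-I) • π (X ⟨x, μ⟩ + X ⟨x.shift μ, ν⟩ - X ⟨x.shift ν, μ⟩ - X ⟨x, ν⟩))) 0 := by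
  set C : MatA 2 := X ⟨x, μ⟩ + X ⟨x.shift μ, ν⟩ - X ⟨x.shift ν, μ⟩ - X ⟨x, ν⟩ with hC
  have hp := hasDerivAt_plaqU_one h1 hW μ ν x
  have hp1 : plaqU (torusT P i) (dirForm (W 0)) μ ν x = 1 := plaqU_zero_eq_one h1 μ ν x
  have hpi := hasDerivAt_units_inv_one (u := fun t => plaqU (torusT P i) (dirForm (W t)) μ ν x) hp1 hp
  have hπ : HasFDerivAt (fun A : MatA 2 => π A) (LinearMap.toContinuousLinearMap (π.restrictScalars ℝ)) (imC (plaqU (torusT P i) (dirForm (W 0)) μ ν x)) :=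
    (LinearMap.toContinuousLinearMap (π.restrictScalars ℝ)).hasFDerivAt
  have himC : HasDerivAt (fun t => imC (plaqU (torusT P i) (dirForm (W t)) μ ν x)) ((2 * I)⁻¹ • (C - -C)) 0 := by
    unfold imC
    exact (hp.sub hpi).const_smul ((2 * I)⁻¹ : ℂ)
  have hcomp := hπ.comp_hasDerivAt 0 himC
  unfold imPlaq
  refine (hcomp.const_smul (((ξ : ℂ)⁻¹) ^ 2)).congr_deriv ?_
  congr 1
  show π ((2 * I)⁻¹ • (C - -C)) = (-I) • π C
  rw [sub_neg_eq_add, ← two_smul ℂ C, smul_smul, map_smul]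
  congr 1
  rw [mul_inv, mul_comm, ← mul_assoc, mul_inv_cancel₀ two_ne_zero, one_mul, Complex.inv_I]

/-- **The `D*_ν`-term linearised at `𝐔 ≡ 1` with data vanishing at `0`**: `(R(W(x−e_ν,x)) G(x−e_ν) − G(x))'(0) = G'(x−e_ν) − G'(x)` when `G(0) = 0`.
[cite: Balaban1985BackgroundPropagators, (3.8) p.392] -/
theorem hasDerivAt_covDstar_one {W : ℝ → PBond P i → (MatA 2)ˣ} {X : PBond P i → MatA 2} (h1 : ∀ b, W 0 b = 1)
    (hW : ∀ b, HasDerivAt (fun t => (W t b : MatA 2)) (X b) 0) {G : ℝ → Site P i → MatA 2} {G' : Site P i → MatA 2}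
    (hG0 : ∀ y, G 0 y = 0) (hG : ∀ y, HasDerivAt (fun t => G t y) (G' y) 0) (ν : Fin P.d) (x : Site P i) :
    HasDerivAt (fun t => covDstar (torusT P i) (dirForm (W t)) ν (G t) x) (G' (x.unshift ν) - G' x) 0 := by
  have hfun : (fun t => covDstar (torusT P i) (dirForm (W t)) ν (G t) x) =
      fun t => (((W t ⟨x.unshift ν, ν⟩)⁻¹ : (MatA 2)ˣ) : MatA 2) * G t (x.unshift ν) * (W t ⟨x.unshift ν, ν⟩ : MatA 2) - G t x := by
    funext t
    simp only [covDstar, R, inv_inv, torusT_symm_apply, dirForm_apply]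
  rw [hfun]
  have h := (((hasDerivAt_units_inv_one (h1 _) (hW ⟨x.unshift ν, ν⟩)).mul (hG (x.unshift ν))).mul (hW ⟨x.unshift ν, ν⟩)).sub (hG x)
  refine h.congr_deriv ?_
  simp only [Pi.mul_apply, h1, hG0, Units.val_one, inv_one, mul_one, one_mul, mul_zero, zero_mul, add_zero, zero_add]

/-- ★★ **THE LINEARISED CURRENT AT THE FLAT BACKGROUND** ((1.8) differentiated at `𝐔 ≡ 1`, where `J(1) = 0`): for a family `W` of bond variables with `W 0 = 1` and
`(W · b)'(0) = X b`, `(J(W))'(0)(x, μ) = ξ⁻¹ · Σ_ν [F_{μν}(x) − F_{μν}(x − e_ν)]` with `F_{μν}(x) = −iξ⁻² π (dX)(p_{μν}(x))` — i.e. `−i ξ⁻³ π (d*dX)(x, μ)`.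
[cite: Balaban1987RG1, (1.8) p.261; Balaban1985BackgroundPropagators, (3.4), (3.9) pp.391–392] -/
theorem hasDerivAt_current_one {W : ℝ → PBond P i → (MatA 2)ˣ} {X : PBond P i → MatA 2} (h1 : ∀ b, W 0 b = 1)
    (hW : ∀ b, HasDerivAt (fun t => (W t b : MatA 2)) (X b) 0) (π : MatA 2 →ₗ[ℂ] MatA 2) (ξ : ℝ) (b : PBond P i) :
    HasDerivAt (fun t => current π ξ (W t) b)
      (((ξ : ℂ)⁻¹) • ∑ ν : Fin P.d,
        ((((ξ : ℂ)⁻¹) ^ 2) • ((-I) • π (X ⟨b.src, b.dir⟩ + X ⟨b.src.shift b.dir, ν⟩ - X ⟨b.src.shift ν, b.dir⟩ - X ⟨b.src, ν⟩)) -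
         (((ξ : ℂ)⁻¹) ^ 2) • ((-I) • π (X ⟨b.src.unshift ν, b.dir⟩ + X ⟨(b.src.unshift ν).shift b.dir, ν⟩ - X ⟨(b.src.unshift ν).shift ν, b.dir⟩ -
            X ⟨b.src.unshift ν, ν⟩)))) 0 := by
  have hfun : (fun t => current π ξ (W t) b) =
      fun t => -(((ξ : ℂ)⁻¹) • ∑ ν : Fin P.d, covDstar (torusT P i) (dirForm (W t)) ν (imPlaq π ξ (W t) b.dir ν) b.src) := by
    funext t; exact current_eq_sum π ξ (W t) b
  rw [hfun]
  have hG0 : ∀ ν y, imPlaq π ξ (W 0) b.dir ν y = 0 := by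
    intro ν y
    unfold imPlaq
    rw [plaqU_zero_eq_one h1, imC_one, map_zero, smul_zero]
  have hsum := HasDerivAt.fun_sum (u := Finset.univ) fun ν _ =>
    hasDerivAt_covDstar_one h1 hW (hG0 ν) (fun y => hasDerivAt_imPlaq_one h1 hW π ξ b.dir ν y) ν b.src
  refine ((hsum.const_smul ((ξ : ℂ)⁻¹)).neg).congr_deriv ?_
  rw [← smul_neg, ← Finset.sum_neg_distrib]
  congr 1
  refine Finset.sum_congr rfl fun ν _ => ?_
  rw [neg_sub]

/-- **Collected form**: `ξ⁻¹ Σ_ν [ξ⁻²(−i)π C_ν − ξ⁻²(−i)π C′_ν] = ξ⁻³ · (−i) · π(Σ_ν (C_ν − C′_ν))`. [cite: Balaban1987RG1, (1.8) p.261 (bookkeeping)] -/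
theorem current_lin_eq (π : MatA 2 →ₗ[ℂ] MatA 2) (ξ : ℝ) (C C' : Fin P.d → MatA 2) :
    ((ξ : ℂ)⁻¹) • ∑ ν : Fin P.d, ((((ξ : ℂ)⁻¹) ^ 2) • ((-I) • π (C ν)) - (((ξ : ℂ)⁻¹) ^ 2) • ((-I) • π (C' ν))) =
      (((ξ : ℂ)⁻¹) ^ 3) • ((-I) • π (∑ ν : Fin P.d, (C ν - C' ν))) := by
  have h : ∀ ν, (((ξ : ℂ)⁻¹) ^ 2) • ((-I) • π (C ν)) - (((ξ : ℂ)⁻¹) ^ 2) • ((-I) • π (C' ν)) = (((ξ : ℂ)⁻¹) ^ 2) • ((-I) • π (C ν - C' ν)) := by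
    intro ν; rw [map_sub, smul_sub, smul_sub]
  rw [Finset.sum_congr rfl fun ν _ => h ν, ← Finset.smul_sum, ← Finset.smul_sum, ← map_sum, smul_smul, ← pow_succ']

/-- **Norm of the linearised current**: `‖ξ⁻³·(−i)·π M‖ ≤ ξ⁻³ · ‖π‖ · ‖M‖` (`ξ > 0`; `‖π‖` the operator norm of `π` as a real-linear map). [cite: Balaban1987RG1, (1.8) p.261 (bookkeeping)] -/
theorem norm_current_lin_le (π : MatA 2 →ₗ[ℂ] MatA 2) {ξ : ℝ} (hξ : 0 < ξ) (M : MatA 2) :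
    ‖(((ξ : ℂ)⁻¹) ^ 3) • ((-I) • π M)‖ ≤ (ξ⁻¹) ^ 3 * ‖LinearMap.toContinuousLinearMap (π.restrictScalars ℝ)‖ * ‖M‖ := by
  rw [norm_smul, norm_smul, norm_neg, Complex.norm_I, one_mul, norm_pow, norm_inv, Complex.norm_real, Real.norm_of_nonneg hξ.le, mul_assoc]
  exact mul_le_mul_of_nonneg_left ((LinearMap.toContinuousLinearMap (π.restrictScalars ℝ)).le_opNorm M) (by positivity)

end Calculus

/-! ## §3  At the record: the `𝐉`-block of the responses is the linearised current applied to `DU(0)` -/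

section Record

variable (F : T4Family) (θ : Stage13Params F 2)

/-- ★★ **`G_k` ON THE `𝐉`-COORDINATES = 𝔰𝔩₂-COORDINATES OF THE LINEARISED CURRENT**: if the rooted-gauge background field `U : B ↦ (U_{k+1}(W_B)(b))_b` is differentiable
at `B = 0` with derivative `U′` and `ι` is differentiable there (standing range, `0 < εbg`), then for every label `y`, colour `a`, bond `b = (x, μ)` and 𝔰𝔩₂-colour `c`:
`recordGkJ … a y (b, 𝐉, c) = sl2Coord (−iξ⁻³ π (d*d (U′δ_{y,a}))(x, μ)) c`, `ξ = L^{−(k+1)}`, `π = sl2Proj` — [I] (1.8) linearised at the flat background ([15] (182) for the current).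
[cite: Balaban1987RG1, (1.8) p.261, (4.35) p.290; Balaban1985Variational, (182) p.307] -/
theorem recordGkJ_inr_eq (k K : ℕ) (hk : k + 1 ≤ (F.P K).m + (F.P K).K) (hε : 0 < θ.εbg)
    (U' : letI := θ.instVβ₁; letI := θ.instVβ₂; (Fin (F.P K).d → Site (F.P K) (k + 1) → θ.Vβ) →L[ℝ] (PBond (F.P K) 0 → MatA 2))
    (hU : letI := θ.instVβ₁; letI := θ.instVβ₂;
      HasFDerivAt (fun B : Fin (F.P K).d → Site (F.P K) (k + 1) → θ.Vβ => fun b : PBond (F.P K) 0 => ((recordBgField F θ k K B b : SU 2) : MatA 2)) U' 0)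
    (hE : letI := θ.instVβ₁; letI := θ.instVβ₂; DifferentiableAt ℝ (recordEmbJ F θ k K) 0)
    (a : θ.ιβ) (y : RespLabel F k K) (b : PBond (F.P K) 0) (c : Fin 3) :
    letI := θ.instVβ₁; letI := θ.instVβ₂; letI := θ.instιβ;
    recordGkJ F θ k K a y (chartEquivJ F K (b, Sum.inr c)) =
      sl2Coord (((((F.P K).eta (k + 1) : ℂ)⁻¹) ^ 3) • ((-I) • sl2Proj (∑ ν : Fin (F.P K).d,
        ((U' (Pi.single y.1 (Pi.single y.2 (θ.bV a))) ⟨b.src, b.dir⟩ + U' (Pi.single y.1 (Pi.single y.2 (θ.bV a))) ⟨b.src.shift b.dir, ν⟩ -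
            U' (Pi.single y.1 (Pi.single y.2 (θ.bV a))) ⟨b.src.shift ν, b.dir⟩ - U' (Pi.single y.1 (Pi.single y.2 (θ.bV a))) ⟨b.src, ν⟩) -
          (U' (Pi.single y.1 (Pi.single y.2 (θ.bV a))) ⟨b.src.unshift ν, b.dir⟩ + U' (Pi.single y.1 (Pi.single y.2 (θ.bV a))) ⟨(b.src.unshift ν).shift b.dir, ν⟩ -
            U' (Pi.single y.1 (Pi.single y.2 (θ.bV a))) ⟨(b.src.unshift ν).shift ν, b.dir⟩ - U' (Pi.single y.1 (Pi.single y.2 (θ.bV a))) ⟨b.src.unshift ν, ν⟩))))) c := by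
  letI := θ.instVβ₁; letI := θ.instVβ₂; letI := θ.instιβ
  set δ : Fin (F.P K).d → Site (F.P K) (k + 1) → θ.Vβ := Pi.single y.1 (Pi.single y.2 (θ.bV a)) with hδ
  -- the line `t ↦ t • δ`
  have hℓ : HasDerivAt (fun t : ℝ => t • δ) δ 0 :=
    ((hasDerivAt_id (0 : ℝ)).smul_const δ).congr_deriv (one_smul ℝ δ)
  have hℓ0 : (fun t : ℝ => t • δ) 0 = 0 := zero_smul ℝ δ
  -- derivative of `ι` along the line, on the coordinate `(b, 𝐉, c)`
  have hEℓ : HasDerivAt (fun t : ℝ => recordEmbJ F θ k K (t • δ)) (fderiv ℝ (recordEmbJ F θ k K) 0 δ) 0 :=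
    hE.hasFDerivAt.comp_hasDerivAt_of_eq 0 hℓ hℓ0.symm
  have hEi : HasDerivAt (fun t : ℝ => recordEmbJ F θ k K (t • δ) (chartEquivJ F K (b, Sum.inr c)))
      (fderiv ℝ (recordEmbJ F θ k K) 0 δ (chartEquivJ F K (b, Sum.inr c))) 0 := (hasDerivAt_pi.1 hEℓ) _
  -- the bond variables along the line
  have hUℓ : HasDerivAt (fun t : ℝ => fun b' : PBond (F.P K) 0 => ((recordBgField F θ k K (t • δ) b' : SU 2) : MatA 2)) (U' δ) 0 :=
    hU.comp_hasDerivAt_of_eq 0 hℓ hℓ0.symm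
  have hW : ∀ b' : PBond (F.P K) 0, HasDerivAt (fun t : ℝ => ((recordBgUnits F θ k K (t • δ) b' : (MatA 2)ˣ) : MatA 2)) (U' δ b') 0 :=
    fun b' => (hasDerivAt_pi.1 hUℓ) b'
  have h1 : ∀ b' : PBond (F.P K) 0, recordBgUnits F θ k K ((0 : ℝ) • δ) b' = 1 := by
    intro b'
    rw [zero_smul, recordBgUnits_zero F θ k K hk hε]
    rfl
  have hJ := hasDerivAt_current_one (W := fun t : ℝ => recordBgUnits F θ k K (t • δ)) h1 hW sl2Proj ((F.P K).eta (k + 1)) b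
  rw [current_lin_eq] at hJ
  obtain ⟨Lc, hLc, hc⟩ := hasFDerivAt_sl2Coord c (recordCurrent F θ k K ((0 : ℝ) • δ) b)
  have hcomp := hc.comp_hasDerivAt_of_eq 0 hJ rfl
  have hfun : (fun t : ℝ => recordEmbJ F θ k K (t • δ) (chartEquivJ F K (b, Sum.inr c))) =
      (fun A : MatA 2 => sl2Coord A c) ∘ fun t : ℝ => current sl2Proj ((F.P K).eta (k + 1)) (recordBgUnits F θ k K (t • δ)) b := by
    funext t
    simp [recordEmbJ, recordCurrent]
  rw [hfun] at hEi
  have huniq := hEi.unique hcomp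
  show fderiv ℝ (recordEmbJ F θ k K) 0 δ (chartEquivJ F K (b, Sum.inr c)) = _
  rw [huniq, hLc]

open scoped Classical in
/-- ★★ **THE `𝐉`-BLOCK CHART MATRIX OF A CUT RESPONSE IS THE LINEARISED CURRENT**: under the hypotheses of `recordGkJ_inr_eq`, on a bond `b ∈ X` the `𝐉`-block of
`cutTo (recordCXJ X) (recordGkJ … a y)` is `−iξ⁻³ π (d*d (U′δ_{y,a}))(b)` itself (traceless: `π = sl2Proj`), and `0` off `X` — the entry of (R1ᴰ)'s gauge through the
`𝐉`-clause of `recordDom44J`. [cite: Balaban1987RG1, (1.8) p.261, (4.4) p.281, (4.35) p.290] -/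
theorem chartMatJc_cutTo_recordGkJ (k K : ℕ) (hk : k + 1 ≤ (F.P K).m + (F.P K).K) (hε : 0 < θ.εbg)
    (U' : letI := θ.instVβ₁; letI := θ.instVβ₂; (Fin (F.P K).d → Site (F.P K) (k + 1) → θ.Vβ) →L[ℝ] (PBond (F.P K) 0 → MatA 2))
    (hU : letI := θ.instVβ₁; letI := θ.instVβ₂;
      HasFDerivAt (fun B : Fin (F.P K).d → Site (F.P K) (k + 1) → θ.Vβ => fun b : PBond (F.P K) 0 => ((recordBgField F θ k K B b : SU 2) : MatA 2)) U' 0)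
    (hE : letI := θ.instVβ₁; letI := θ.instVβ₂; DifferentiableAt ℝ (recordEmbJ F θ k K) 0)
    (a : θ.ιβ) (y : RespLabel F k K) {Mc : ℕ} (X : (recordDomSys F Mc k K).Dom) (b : PBond (F.P K) 0) :
    letI := θ.instVβ₁; letI := θ.instVβ₂; letI := θ.instιβ;
    chartMatJc F K (B12FormatPlus.cutTo (recordCXJ F Mc k K X) (recordGkJ F θ k K a y)) b =
      if b ∈ domBonds F Mc k K X then
        ((((F.P K).eta (k + 1) : ℂ)⁻¹) ^ 3) • ((-I) • sl2Proj (∑ ν : Fin (F.P K).d,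
        ((U' (Pi.single y.1 (Pi.single y.2 (θ.bV a))) ⟨b.src, b.dir⟩ + U' (Pi.single y.1 (Pi.single y.2 (θ.bV a))) ⟨b.src.shift b.dir, ν⟩ -
            U' (Pi.single y.1 (Pi.single y.2 (θ.bV a))) ⟨b.src.shift ν, b.dir⟩ - U' (Pi.single y.1 (Pi.single y.2 (θ.bV a))) ⟨b.src, ν⟩) -
          (U' (Pi.single y.1 (Pi.single y.2 (θ.bV a))) ⟨b.src.unshift ν, b.dir⟩ + U' (Pi.single y.1 (Pi.single y.2 (θ.bV a))) ⟨(b.src.unshift ν).shift b.dir, ν⟩ -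
            U' (Pi.single y.1 (Pi.single y.2 (θ.bV a))) ⟨(b.src.unshift ν).shift ν, b.dir⟩ - U' (Pi.single y.1 (Pi.single y.2 (θ.bV a))) ⟨b.src.unshift ν, ν⟩))))
      else 0 := by
  letI := θ.instVβ₁; letI := θ.instVβ₂; letI := θ.instιβ
  classical
  have hmem : ∀ c : Fin 3, chartEquivJ F K (b, Sum.inr c) ∈ recordCXJ F Mc k K X ↔ b ∈ domBonds F Mc k K X := fun c => by simp [recordCXJ]
  by_cases hb : b ∈ domBonds F Mc k K X
  · rw [if_pos hb]
    have htr : ∀ (z w : ℂ) (M : MatA 2), (z • (w • sl2Proj M)).trace = 0 := by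
      intro z w M; rw [Matrix.trace_smul, Matrix.trace_smul, trace_sl2Proj, smul_zero, smul_zero]
    rw [← sum_sl2Coord_smul_sl2Gen_of_trace_eq_zero (htr _ _ _)]
    unfold chartMatJc
    refine Finset.sum_congr rfl fun c _ => ?_
    rw [B12FormatPlus.cutTo_apply, if_pos ((hmem c).2 hb), recordGkJ_inr_eq F θ k K hk hε U' hU hE a y b c]
  · rw [if_neg hb]
    unfold chartMatJc
    refine Finset.sum_eq_zero fun c _ => ?_
    rw [B12FormatPlus.cutTo_apply, if_neg (mt (hmem c).1 hb), zero_smul]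

end Record

/-! ## §4  The `𝐉`-block under TokP9L ∕ LR4: `d*d D = d*d Hr` and the bound by the fourth (190)-clause -/

section Bound

/-- **`d(dφ) = 0` on the lattice**: if `D = Hr + dφ` bondwise (`(dφ)(x, μ) = φ(x) − φ(x + e_μ)`), the lattice curls of `D` and `Hr` agree on every plaquette.
[cite: Balaban1985BackgroundPropagators, (3.4) p.391 (bookkeeping)] -/
theorem curlF_of_exact {P : Params} {V : Type*} [AddCommGroup V] {D Hr : PBond P 0 → V} {φ : Site P 0 → V}
    (hD : ∀ b : PBond P 0, D b = Hr b + (φ b.src - φ (b.src.shift b.dir))) (x : Site P 0) (μ ν : Fin P.d) :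
    D ⟨x, μ⟩ + D ⟨x.shift μ, ν⟩ - D ⟨x.shift ν, μ⟩ - D ⟨x, ν⟩ = Hr ⟨x, μ⟩ + Hr ⟨x.shift μ, ν⟩ - Hr ⟨x.shift ν, μ⟩ - Hr ⟨x, ν⟩ := by
  have hc : (x.shift μ).shift ν = (x.shift ν).shift μ := (B9TorusCalculus.torusT_comm (P := P) (j := 0) ν μ x)
  simp only [hD, hc]
  abel

variable (F : T4Family) (θ : Stage13Params F 2)

/-- ★★★ **THE `𝐉`-BLOCK OF A CUT RESPONSE BOUNDED BY THE FOURTH (190)-CLAUSE OF ⁷″-LR4.**  In the text's currency: `D := fderiv` of the ENTRY map of the rooted background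
field at `0` in the direction `δ_{y,a}` (entry map `C²` at `0` — TokP9reg —, standing range, `0 < εbg`); if `D = Hr + dφ` (TokP9L's Hodge split) and the lattice
`d*d Hr` at the bond `b = (x, μ)` — `Σ_ν [(dHr)(p_{μν}(x)) − (dHr)(p_{μν}(x − e_ν))]` — has sup-entry norm `≤ t`, then on `b ∈ X`
`‖chartMatJc (cutTo (recordCXJ X) (recordGkJ … a y)) b‖ ≤ 2 · ‖π_ℝ‖ · ξ⁻³ · t` (`π_ℝ = sl2Proj` as a real-linear map, `ξ = L^{−(k+1)}`); with LR4's `t = C₉′ξ³e^{−δ₉·tdist}` this is the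
constant-radius `𝐉`-clause rate `2‖π_ℝ‖C₉′·e^{−δ₉·tdist}`.  GAUGE-INDEPENDENT: only `d*d D = d*d Hr` is used (`curlF_of_exact`).
[cite: Balaban1987RG1, (1.8) p.261, (4.4) p.281; Balaban1985Variational, (190) p.308 (fourth line), (182) p.307] -/
theorem norm_chartMatJc_cutTo_recordGkJ_le_of_LR4 (k K : ℕ) (hk : k + 1 ≤ (F.P K).m + (F.P K).K) (hε : 0 < θ.εbg)
    (hd2 : letI := θ.instVβ₁; letI := θ.instVβ₂;
      ContDiffAt ℝ 2 (fun B : Fin (F.P K).d → Site (F.P K) (k + 1) → θ.Vβ =>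
        fun (b : PBond (F.P K) 0) (i i' : Fin 2) => ((recordBgField F θ k K B b : SU 2) : MatA 2) i i') 0)
    (a : θ.ιβ) (y : RespLabel F k K) {Mc : ℕ} (X : (recordDomSys F Mc k K).Dom) (b : PBond (F.P K) 0) (hb : b ∈ domBonds F Mc k K X)
    (Hr : PBond (F.P K) 0 → Fin 2 → Fin 2 → ℂ) (φ : Site (F.P K) 0 → Fin 2 → Fin 2 → ℂ)
    (hD : letI := θ.instVβ₁; letI := θ.instVβ₂; letI := θ.instιβ;
      ∀ b' : PBond (F.P K) 0, fderiv ℝ (fun B : Fin (F.P K).d → Site (F.P K) (k + 1) → θ.Vβ =>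
        fun (b : PBond (F.P K) 0) (i i' : Fin 2) => ((recordBgField F θ k K B b : SU 2) : MatA 2) i i') 0 (Pi.single y.1 (Pi.single y.2 (θ.bV a))) b' =
        Hr b' + (φ b'.src - φ (b'.src.shift b'.dir)))
    {t : ℝ}
    (hL4 : ‖∑ ν : Fin (F.P K).d, ((Hr ⟨b.src, b.dir⟩ + Hr ⟨(b.src).shift b.dir, ν⟩ - Hr ⟨(b.src).shift ν, b.dir⟩ - Hr ⟨b.src, ν⟩) -
        (Hr ⟨b.src.unshift ν, b.dir⟩ + Hr ⟨(b.src.unshift ν).shift b.dir, ν⟩ - Hr ⟨(b.src.unshift ν).shift ν, b.dir⟩ - Hr ⟨b.src.unshift ν, ν⟩))‖ ≤ t) :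
    letI := θ.instVβ₁; letI := θ.instVβ₂; letI := θ.instιβ;
    ‖chartMatJc F K (B12FormatPlus.cutTo (recordCXJ F Mc k K X) (recordGkJ F θ k K a y)) b‖ ≤
      2 * ‖LinearMap.toContinuousLinearMap (sl2Proj.restrictScalars ℝ)‖ * (((F.P K).eta (k + 1))⁻¹) ^ 3 * t := by
  letI := θ.instVβ₁; letI := θ.instVβ₂; letI := θ.instιβ
  obtain ⟨U', hU'eq, hU'⟩ := hasFDerivAt_bgField_of_entries F θ k K (hd2.differentiableAt (by norm_num))
  have hE : DifferentiableAt ℝ (recordEmbJ F θ k K) 0 :=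
    (contDiffAt_recordEmbJ_of F θ k K hk hε (contDiffAt_matrix_of_entries hd2)).differentiableAt (by norm_num)
  have h := chartMatJc_cutTo_recordGkJ F θ k K hk hε U' hU' hE a y X b
  rw [if_pos hb] at h
  rw [h]
  -- rewrite `U′δ b' = Matrix.of (D b') = e (D b')` with the real-linear `Matrix.of`, and `dD = dHr`
  obtain ⟨e, he⟩ := exists_ofCLM
  set D : PBond (F.P K) 0 → Fin 2 → Fin 2 → ℂ := fun b' => fderiv ℝ (fun B : Fin (F.P K).d → Site (F.P K) (k + 1) → θ.Vβ =>
        fun (b : PBond (F.P K) 0) (i i' : Fin 2) => ((recordBgField F θ k K B b : SU 2) : MatA 2) i i') 0 (Pi.single y.1 (Pi.single y.2 (θ.bV a))) b' with hDdef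
  have hUe : ∀ b', U' (Pi.single y.1 (Pi.single y.2 (θ.bV a))) b' = e (D b') := fun b' => by rw [hU'eq, he]
  have hcurl : ∀ (x : Site (F.P K) 0) (μ ν : Fin (F.P K).d),
      U' (Pi.single y.1 (Pi.single y.2 (θ.bV a))) ⟨x, μ⟩ + U' (Pi.single y.1 (Pi.single y.2 (θ.bV a))) ⟨x.shift μ, ν⟩ -
        U' (Pi.single y.1 (Pi.single y.2 (θ.bV a))) ⟨x.shift ν, μ⟩ - U' (Pi.single y.1 (Pi.single y.2 (θ.bV a))) ⟨x, ν⟩ =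
      e (Hr ⟨x, μ⟩ + Hr ⟨x.shift μ, ν⟩ - Hr ⟨x.shift ν, μ⟩ - Hr ⟨x, ν⟩) := by
    intro x μ ν
    rw [hUe, hUe, hUe, hUe, ← map_add, ← map_sub, ← map_sub, curlF_of_exact (D := D) (fun b' => hD b') x μ ν]
  simp_rw [hcurl, ← map_sub, ← map_sum]
  have hξ : 0 < (F.P K).eta (k + 1) := by
    unfold Params.eta
    exact pow_pos (inv_pos.2 (F.P K).cast_L_pos) _
  refine (norm_current_lin_le sl2Proj hξ _).trans ?_
  rw [he]
  have h2 := (norm_of_le_two_mul_norm _).trans (mul_le_mul_of_nonneg_left hL4 zero_le_two)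
  have hπ0 : 0 ≤ (((F.P K).eta (k + 1))⁻¹) ^ 3 * ‖LinearMap.toContinuousLinearMap (sl2Proj.restrictScalars ℝ)‖ := by positivity
  calc (((F.P K).eta (k + 1))⁻¹) ^ 3 * ‖LinearMap.toContinuousLinearMap (sl2Proj.restrictScalars ℝ)‖ * ‖(Matrix.of _ : MatA 2)‖
      ≤ (((F.P K).eta (k + 1))⁻¹) ^ 3 * ‖LinearMap.toContinuousLinearMap (sl2Proj.restrictScalars ℝ)‖ * (2 * t) := mul_le_mul_of_nonneg_left h2 hπ0
    _ = 2 * ‖LinearMap.toContinuousLinearMap (sl2Proj.restrictScalars ℝ)‖ * (((F.P K).eta (k + 1))⁻¹) ^ 3 * t := by ring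

end Bound

end Summit.QuantumFields.YangMills.Theorems.PortU8

end
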